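import Literature.IUT.HodgeArakelov.ThetaEvaluationCor112AtModelTate
import Literature.IUT.HodgeArakelov.PointedInversionFunctorialNV
import Literature.AnabelianGeometry.EtaleTheta.SettingModelTateInversionAut
import Literature.AnabelianGeometry.EtaleTheta.SettingModelTateInversionXuu
import HarnessLib

/-!
# [IUTchII] Cor. 1.12 (ii)∧(iii) at the [EtTh] Tate model — the (R1) INVERSION DATA of Rmk. 1.4.1 (ii) are THEOREMS there
# (`ι := inversionχq`, the B8 Prop. 1.2 (i) output `Env₀`; residual (R1) = the uniqueness clause only) (proof-only; D-0079 K-L6)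

S. Mochizuki, *Inter-universal Teichmüller theory II*, kurims manuscript (Dec. 2020), Rmk. 1.4.1 (ii) pp. 28–29 («the unique
order two `Δ^tp_{X̲̲_k}`-outer automorphism of `Π^tp_{X̲̲_k}` over `G_k`»), Rmk. 2.1.1 (i) p. 65, Cor. 1.12 (ii), (iii)
pp. 56–58 [claim: Mochizuki2012, status: disputed] (IUTchII §1 Cor 1.12, kurims pp.56-58); S. Mochizuki, *The étale theta
function …*, Publ. RIMS **45** (2009) [EtTh], Prop. 1.5 (iii) p. 23 (the inversion automorphism), Def. 2.5 (i) p. 39,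
Cor. 2.18 (i) p. 60 (PRIMS PDF pages) [cite: MochizukiEtTh2009, Cor 2.18(i) p.60].  Cell `abc-iut`, seat abc-iut-w4-d043
(gen 7), row «COR112-AT-MODELTATE» file 2, sequel of `ThetaEvaluationCor112AtModelTate` (p459069).  PROOF-ONLY: no definition,
no instance, no new named fact; abc-iut-L2's stage-2 inversion files (`SettingModelTateInversion{,Aut,Xuu}`), abc-iut-w5-d072's
`inversionAlpha` / `toLZ_inversionAlpha_generator` / `inversionAlpha_inversionAlpha_of_sq`, abc-iut-w4-d010's
`projG_isoX_envOfGroup_eq_one_iff_aug_of_cor218_i` and abc-iut-L6-d6's B8 output `ThetaSetting.envOfGroup` are consumed BY NAME.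

STATE OF RECORD (p459069, `cor112_model_modelTate`).  At the Tate model every [EtTh]-, L3- and [AbsTopIII]-side binder of the
Cor. 1.12 model closer is a theorem; the residual there is the custody list of p439820, among which the (R1) data of the pointed
inversion (GAP G-w4d010-2 (R1), abc-iut-w5-d072): an automorphism `α` of `Π := Π^tp_X̲̲` over `G_K` relative to the Prop. 1.2 (i)
output (`hover`), of order two as a `Δ`-outer automorphism (`δ, hδ, hαα`), reversing the `ℤ`-torsor (`γ, hγ, hαγ`), UNIQUE as
such (`huniq`), together with `hα` («`α` over `K`»), all for an ARBITRARY Prop. 1.2 (i) output `Env`.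

THIS FILE (`cor112_model_modelTate_inversion`).  At the Tate model take `ι := inversionχq p 1 2` — abc-iut-L2's stage-2 inversion of
`Π^tp_X` (`isInversionAut_inversionχq`: over `K`, `−1` on `Z`; `inversionχq_inversionχq`: involutive; `map_Huuχq_inversionχq`:
stabilises `Π^tp_X̲̲`) — and `α := inversionAlpha C ι hι` (its restriction to `Π^tp_X̲̲`), `δ := 1`, `γ :=` a `toLZ`-generator
(`toLZ_surjective`), and FIX the Prop. 1.2 (i) output to be abc-iut-L6-d6's GENUINE B8 output `Env₀ := ThetaSetting.envOfGroup …`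
of the Tate curve at ANY identification `hP` (its `isoX` is `hP.some`, its `projG` the quotient by `Ker(aug)`).  Then, besides
everything already discharged in p459069: `hα` (`aug_inversionAlpha`), `hαα` (`inversionAlpha_inversionAlpha_of_sq` at `e := 1`),
`hγ`/`hαγ` (`toLZ_inversionAlpha_generator` + `IsInversionAut.toZ_apply`), `hδ` (`map_one`) are theorems OUTRIGHT, and `hover`
(«`α` over `G_k` through `Env₀`») FOLLOWS from [EtTh] Cor. 2.18 (i) at level `1` ALONE (F-0620 at the instance, the residual the
sibling rows II:Cor1.10/1.11 @ modelTate already carry): `projG_isoX_envOfGroup_inversionAlpha_of_cor218_i` — `projG ∘ isoX` is a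
homomorphism killing exactly `Ker(aug)` (abc-iut-w4-d010), and `aug (α x) = aug x`.  RESIDUAL of the (R1) group: `huniq` ONLY (the
tempered-anabelian uniqueness clause of Rmk. 1.4.1 (ii), relative to `Env₀` and `α`); the other custody items ((H1) `hcharY`/`hΔX`,
the point data «`y = μ_-`», `β hφ hβ`, the Prop. 2.2 (ii) translates, `G`) stay VERBATIM; `Env` is no longer a binder (`Env₀` is
DATA of the tree, for every `hP`).  Conclusion VERBATIM that of p439820 at these data.  Generic lemmas (§1) are stated for any
[EtTh] §1 setting with an automorphism `ι` over `K` stabilising `Π^tp_X̲̲`.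

HONEST LABEL: `modelTate` is a SEMI-SYNTHETIC model of the typed [EtTh] §1 interface: this is OUR kernel check that the EXISTENCE
half of the Rmk. 1.4.1 (ii) inversion data is realised, jointly with every other non-custody binder of the Cor. 1.12 model closer,
at one genuine (non-toy) carrier; the UNIQUENESS half is not touched; the [IUTchII] claim key `Mochizuki2012` is DISPUTED (D-0012)
and nothing of it is asserted; nothing of [EtTh] is asserted beyond the tree's proofs; no side is taken on [IUTchIII] Cor. 3.12;
typed ≠ proved; instantiated ≠ endorsed; nothing here says abc is proved or refuted.
-/

noncomputable section

namespace Literature.IUT.HodgeArakelov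

open Literature.AnabelianGeometry.AbsoluteAnabelian
open Literature.AnabelianGeometry.EtaleTheta Literature.AnabelianGeometry.SemiGraphs CohomologySystemOfContH1
open Literature.AnabelianGeometry.EtaleTheta.SettingModel
open Literature.NumberTheory.GaloisRepresentations
open scoped Literature.AnabelianGeometry.EtaleTheta

/-! ## §1. Generic: an automorphism `ι` of `Π^tp_X` over `K` stabilising `Π^tp_X̲̲`, and the B8 Prop. 1.2 (i) output -/

namespace EtaleThetaDataOfSetting

variable {p : ℕ} [Fact p.Prime] {D : Literature.AnabelianGeometry.EtaleTheta.ThetaSetting p}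
  {E : D.EtaleThetaData} {l : ℕ} (C : E.DoubleUnderline l) (ι : D.PiTemp ≃ₜ* D.PiTemp)

/-- An INVOLUTIVE `ι` (`ι ∘ ι = id`, as abc-iut-L2's `inversionχq`) satisfies the «order two as an OUTER automorphism» shape
`ι (ι x) = e·x·e⁻¹` of abc-iut-w5-d072's `inversionAlpha_inversionAlpha_of_sq` with `e := 1 ∈ Π^tp_X̲̲`.
[claim: Mochizuki2012, status: disputed] (IUTchII §1 Rmk 1.4.1 (ii), kurims p.28) -/
theorem sq_conj_one_of_involutive (h : ∀ x : D.PiTemp, ι (ι x) = x) (x : D.PiTemp) :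
    ι (ι x) = ((1 : Pi C) : D.PiTemp) * x * ((1 : Pi C) : D.PiTemp)⁻¹ := by
  rw [h, OneMemClass.coe_one, one_mul, inv_one, mul_one]

variable (hι : C.Huu.map ι.toMulEquiv.toMonoidHom = C.Huu)

/-- **`α := ι|Π^tp_X̲̲` lies over `K`** (the closer's binder `hα`: `ε(α x) = ε(x)`) when `ι` does ([EtTh] Prop. 1.5 (iii): the
inversion automorphism commutes with `Π^tp_X ↠ G_K`; `IsInversionAut.aug_apply`). [cite: MochizukiEtTh2009, Prop 1.5 (iii) p.23] -/
theorem aug_inversionAlpha (hιA : D.IsInversionAut ι) (x : Pi C) :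
    aug C (inversionAlpha C ι hι x) = aug C x :=
  hιA.aug_apply (x : D.PiTemp)

/-- At abc-iut-L6-d6's B8 Prop. 1.2 (i) output `Env₀ := ThetaSetting.envOfGroup …` of the Tate curve (any identification `hP`):
`projG (isoX 1) = 1` — the closer's binder `hδ` at `δ := 1`. [claim: Mochizuki2012, status: disputed] (IUTchII §1 Prop 1.2 (i), kurims p.25) -/
theorem projG_isoX_envOfGroup_one {N : ℕ+} (μ : D.CyclotomeMod l N) (hC : D.Compat) (hS : D.Sec2Hyps)
    (h15 : Literature.AnabelianGeometry.EtaleTheta.ThetaSetting.Prop15iii E hC) (L : C.CuspLabels) (hl : l.Prime)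
    (hp2 : p ≠ 2) (hpl : p ≠ l) (hζ : ∃ ζ : D.K, IsPrimitiveRoot ζ (4 * l))
    {η : (C.thetaEnvData μ hC hS).PiYdd → MuN p N} (hη : η ∈ (C.thetaEnvData μ hC hS).thetaCocycles)
    (hZ : Nonempty (ModelCyclotomes.lDeltaQuot (C.rigidData μ hC hS h15 L) ≃* Literature.IUT.HodgeTheaters.ZHat))
    (hP : Nonempty ((Pi C) ≃ₜ* (ThetaSetting.ofDoubleUnderline C μ hC hS hl hp2 hpl hζ hη).PiX)) :
    (ThetaSetting.envOfGroup (C.rigidData μ hC hS h15 L)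
          (ThetaSetting.SideData.ofDoubleUnderline C μ hC hS hl hp2 hpl hζ hη) (ThetaSetting.t1Space_Huu C)
          (ThetaSetting.isClosed_ker_aug_thetaEnvData C μ hC hS) hZ (Pi C) hP).recon.projG
        ((ThetaSetting.envOfGroup (C.rigidData μ hC hS h15 L)
          (ThetaSetting.SideData.ofDoubleUnderline C μ hC hS hl hp2 hpl hζ hη) (ThetaSetting.t1Space_Huu C)
          (ThetaSetting.isClosed_ker_aug_thetaEnvData C μ hC hS) hZ (Pi C) hP).isoX 1) = 1 := by
  rw [map_one, map_one]

/-- **`hover` at the B8 output, modulo F-0620 ONLY**: for an automorphism `ι` of `Π^tp_X` over `K` stabilising `Π^tp_X̲̲`, its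
restriction `α` lies «over `G_k`» through the GENUINE Prop. 1.2 (i) output `Env₀` of the Tate curve — `projG (isoX (α x)) =
projG (isoX x)` — for EVERY identification `hP`: `projG ∘ isoX` is a homomorphism whose kernel is exactly `Ker(aug)` by [EtTh]
Cor. 2.18 (i) (abc-iut-w4-d010's `projG_isoX_envOfGroup_eq_one_iff_aug_of_cor218_i`), and `aug (α x) = aug x`.
[claim: Mochizuki2012, status: disputed] (IUTchII §1 Rmk 1.4.1 (ii), kurims p.28) [cite: MochizukiEtTh2009, Cor 2.18(i) p.60] -/
theorem projG_isoX_envOfGroup_inversionAlpha_of_cor218_i {N : ℕ+} (μ : D.CyclotomeMod l N) (hC : D.Compat) (hS : D.Sec2Hyps)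
    (h15 : Literature.AnabelianGeometry.EtaleTheta.ThetaSetting.Prop15iii E hC) (L : C.CuspLabels) (hl : l.Prime)
    (hp2 : p ≠ 2) (hpl : p ≠ l) (hζ : ∃ ζ : D.K, IsPrimitiveRoot ζ (4 * l))
    {η : (C.thetaEnvData μ hC hS).PiYdd → MuN p N} (hη : η ∈ (C.thetaEnvData μ hC hS).thetaCocycles)
    (hZ : Nonempty (ModelCyclotomes.lDeltaQuot (C.rigidData μ hC hS h15 L) ≃* Literature.IUT.HodgeTheaters.ZHat))
    (hP : Nonempty ((Pi C) ≃ₜ* (ThetaSetting.ofDoubleUnderline C μ hC hS hl hp2 hpl hζ hη).PiX))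
    (R : RigidData.{0} N l) (hR : R = C.rigidData μ hC hS h15 L)
    (h218i : R.Cor218_i) (hιA : D.IsInversionAut ι) (x : Pi C) :
    (ThetaSetting.envOfGroup (C.rigidData μ hC hS h15 L)
          (ThetaSetting.SideData.ofDoubleUnderline C μ hC hS hl hp2 hpl hζ hη) (ThetaSetting.t1Space_Huu C)
          (ThetaSetting.isClosed_ker_aug_thetaEnvData C μ hC hS) hZ (Pi C) hP).recon.projG
        ((ThetaSetting.envOfGroup (C.rigidData μ hC hS h15 L)
          (ThetaSetting.SideData.ofDoubleUnderline C μ hC hS hl hp2 hpl hζ hη) (ThetaSetting.t1Space_Huu C)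
          (ThetaSetting.isClosed_ker_aug_thetaEnvData C μ hC hS) hZ (Pi C) hP).isoX (inversionAlpha C ι hι x)) =
    (ThetaSetting.envOfGroup (C.rigidData μ hC hS h15 L)
          (ThetaSetting.SideData.ofDoubleUnderline C μ hC hS hl hp2 hpl hζ hη) (ThetaSetting.t1Space_Huu C)
          (ThetaSetting.isClosed_ker_aug_thetaEnvData C μ hC hS) hZ (Pi C) hP).recon.projG
        ((ThetaSetting.envOfGroup (C.rigidData μ hC hS h15 L)
          (ThetaSetting.SideData.ofDoubleUnderline C μ hC hS hl hp2 hpl hζ hη) (ThetaSetting.t1Space_Huu C)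
          (ThetaSetting.isClosed_ker_aug_thetaEnvData C μ hC hS) hZ (Pi C) hP).isoX x) := by
  have key := projG_isoX_envOfGroup_eq_one_iff_aug_of_cor218_i C μ hC hS h15 L hl hp2 hpl hζ hη hZ hP R hR h218i
  rw [← inv_mul_eq_one, ← map_inv, ← map_mul, ← map_inv, ← map_mul, key]
  show D.aug ((ι (x : D.PiTemp))⁻¹ * (x : D.PiTemp)) = 1
  rw [map_mul, map_inv, hιA.aug_apply, inv_mul_cancel]

end EtaleThetaDataOfSetting

/-! ## §2. [IUTchII] Cor. 1.12 (ii)∧(iii) at the Tate model with the (R1) existence data and `hα` DISCHARGED -/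

namespace ModelTateCarriers

variable (p : ℕ) [Fact p.Prime] (l : ℕ+) (hl : Odd (l : ℕ)) (hlp : (l : ℕ).Prime) (hdvd : 4 * (l : ℕ) ∣ p - 1)
  {Es : Set ℕ+} (τ : (ThetaSetting.modelχq p 1 2 even_two).CyclotomeTower l Es)

/-- **[IUTchII] Cor. 1.12 (ii) AND (iii) at the model, AT THE [EtTh] TATE MODEL, with the Rmk. 1.4.1 (ii) inversion EXISTENCE data
THEOREMS** — `cor112_model_modelTate` (p459069) with, in addition: the Prop. 1.2 (i) output FIXED to the genuine B8 output `Env₀`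
(any `hP`), `α := inversionAlpha C (inversionχq p 1 2) _`, `δ := 1`, `γ :=` a `toLZ`-generator, and `hα`, `hαα`, `hγ`, `hαγ`,
`hδ` theorems outright, `hover` from F-0620 at level `1` (`h218i₁`).  Residual `∀`-binders: `hP` (inhabited), `h218i₁` (F-0620 at
the instance), (H1) `hcharY`, the (R1) UNIQUENESS clause `huniq`, the point data «`y = μ_-`», `β hφ`, (H1) `hΔX`, `hβ`, the
Prop. 2.2 (ii) translates, `G`.  Conclusion verbatim that of p439820/p459069 at these data.
[claim: Mochizuki2012, status: disputed] (IUTchII §1 Cor 1.12 (ii)(iii), kurims pp.56-58) -/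
theorem cor112_model_modelTate_inversion :
    -- (R1) AT THE TATE MODEL: abc-iut-L2's stage-2 inversion `ι := inversionχq` of `Π^tp_X` (over `K`, `−1` on `Z`, involutive)
    let ι := inversionχq p 1 2
    let hιA : (ThetaSetting.modelχq p 1 2 even_two).IsInversionAut ι := isInversionAut_inversionχq p 1 2 even_two
    let hC := compat_modelχq p 1 2 even_two
    let hS := ThetaSetting.modelχq_sec2Hyps p 1 2 even_two
    let K₀ := (kummerCoreχq p 1 2 even_two).toKummerDataOfSection SemidirectProduct.inr (continuous_inrχq p 1 2)
        (fun _ => rfl) (map_inr_GK_le_GtpY_modelχq' p 1 2 even_two) (map_inr_GKdd_le_GtpYdd_modelχq' p 1 2 even_two)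
    let C := (K₀.etaleThetaDataOfClass (etaDdχq p 1 2 even_two)).doubleUnderlineχqOfEtaRes p 1 2 l hl
        (eta_res_etaDdχq p 1 2 even_two l hl)
    -- the ROOT COCYCLE of the `EtaleLevels` chain: abc-iut-L6-t1's one-root lift (abc-iut-w5-d233 `rootLift_mem_rootCocycles`)
    let f := EtaleThetaDataOfSetting.rootLift C
    let hf : f ∈ C.rootCocycles hC := rootLift_mem_rootCocycles C hC
    let h15 : Literature.AnabelianGeometry.EtaleTheta.ThetaSetting.Prop15iii _ hC :=
      prop15iii_etaleThetaDataOfClass_etaDdχq p hC SemidirectProduct.inr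
        (continuous_inrχq p 1 2) (fun _ => rfl) (map_inr_GK_le_GtpY_modelχq' p 1 2 even_two)
        (map_inr_GKdd_le_GtpYdd_modelχq' p 1 2 even_two)
    let L : C.CuspLabels := ⟨fun _ => ∅, fun _ => ∅, fun _ => rfl⟩
    let hO := ThetaSetting.modelχq_isEtThOrigin p 1 2 even_two
    let hYcl := hYcl_modelχq p 1 2 even_two
    let hp2 := ne_two_of_four_mul_dvd_pred p l.pos hdvd
    let hpl := ne_of_four_mul_dvd_pred p l.pos hdvd
    let hζ := exists_isPrimitiveRoot_K_modelχq p 1 2 even_two l.pos hdvd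
    let hZ : ∀ M : ℕ+, Nonempty (ModelCyclotomes.lDeltaQuot (C.rigidData (τ.modAll M) hC hS h15 L) ≃*
        Literature.IUT.HodgeTheaters.ZHat) := fun M =>
      ModelCyclotomes.nonempty_lDeltaQuot_rigidData_mulEquiv_zHat C (τ.modAll M) hC hS h15 L hO hYcl hlp.ne_zero
    -- the generic instances of the Cor. 1.12 vocabulary, re-supplied at the (reducible) Tate-model carriers
    haveI : ((ThetaSetting.modelχq p 1 2 even_two).lDeltaTheta l).Normal := (ThetaSetting.modelχq p 1 2 even_two).lDeltaTheta_normal l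
    haveI : IsMulCommutative ((ThetaSetting.modelχq p 1 2 even_two).lDeltaTheta l) :=
      EtaleThetaDataOfSetting.instIsMulCommutative_lDeltaTheta (D := ThetaSetting.modelχq p 1 2 even_two) l
    letI : MulDistribMulAction (EtaleThetaDataOfSetting.Pi C) (PadicAlgCl p)ˣ := EtaleThetaDataOfSetting.unitsAction C
    -- the L3 parameter bundle «`Π^temp` tempered, temp-slim, Galois-countable» of `X_v` AT THE TATE MODEL (abc-iut-L3 / L2-t5)
    let gd : (ThetaSetting.modelχq p 1 2 even_two).toTemperedCurve.GroupLevelData := (nonempty_groupLevelData_modelχq p 1 2 even_two).some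
    -- (H2) `Π/Δ ≅ G_K` at the `EtaleLevels` setting of the Tate model: abc-iut-w4-d030's THEOREM `hq_setting_modelTate` (p456925)
    let hq : Nonempty (TopGroup.quot (EtaleLevels.setting C hC hS hlp hp2 hpl hζ τ.modAll f hf).PiX
        (EtaleLevels.setting C hC hS hlp hp2 hpl hζ τ.modAll f hf).DeltaX ≃ₜ*
        (EtaleLevels.setting C hC hS hlp hp2 hpl hζ τ.modAll f hf).Gk) :=
      hq_setting_modelTate p l hl hlp hdvd τ
    -- `ι` stabilises `Π^tp_X̲̲`; `α := ι|Π^tp_X̲̲` (abc-iut-w5-d072 `inversionAlpha`); `δ := 1`; a `toLZ`-generator `γ`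
    let hι : C.Huu.map ι.toMulEquiv.toMonoidHom = C.Huu := map_Huuχq_inversionχq p 1 2 l hl
    let α : (EtaleThetaDataOfSetting.Pi C) ≃ₜ* (EtaleThetaDataOfSetting.Pi C) := EtaleThetaDataOfSetting.inversionAlpha C ι hι
    let hαα : ∀ x : EtaleThetaDataOfSetting.Pi C, α (α x) = 1 * x * 1⁻¹ :=
      EtaleThetaDataOfSetting.inversionAlpha_inversionAlpha_of_sq C ι hι 1
        (EtaleThetaDataOfSetting.sq_conj_one_of_involutive C ι (inversionχq_inversionχq p 1 2))
    let γ : EtaleThetaDataOfSetting.Pi C := (C.toLZ_surjective (Multiplicative.ofAdd 1)).choose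
    let hγ : C.toLZ γ = Multiplicative.ofAdd 1 := (C.toLZ_surjective (Multiplicative.ofAdd 1)).choose_spec
    let hαγ : C.toLZ (α γ) = Multiplicative.ofAdd (-1) :=
      EtaleThetaDataOfSetting.toLZ_inversionAlpha_generator C ι hι γ hγ (hιA.toZ_apply γ)
    -- the [IUTchII] Prop. 1.2 (i) output `Env₀ :=` abc-iut-L6-d6's GENUINE `ThetaSetting.envOfGroup` of the Tate curve (bridge B8), for
    -- EVERY identification `hP` (inhabited: `⟨ContinuousMulEquiv.refl _⟩`); its `projG ∘ isoX` kills exactly `Ker(aug)` modulo F-0620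
    ∀ (hP : Nonempty ((EtaleThetaDataOfSetting.Pi C) ≃ₜ* (EtaleLevels.setting C hC hS hlp hp2 hpl hζ τ.modAll f hf).PiX)),
    let Env₀ : EnvOfGroup (EtaleLevels.setting C hC hS hlp hp2 hpl hζ τ.modAll f hf)
        (EtaleLevels.modelSystem C hC hS hlp hp2 hpl hζ τ.modAll f hf τ.red_modAll h15 L hZ).PiX :=
      ThetaSetting.envOfGroup (C.rigidData (τ.modAll 1) hC hS h15 L)
        (ThetaSetting.SideData.ofDoubleUnderline C (τ.modAll 1) hC hS hlp hp2 hpl hζ (EtaleLevels.eta0_mem C hC hS τ.modAll f hf 1))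
        (ThetaSetting.t1Space_Huu C) (ThetaSetting.isClosed_ker_aug_thetaEnvData C (τ.modAll 1) hC hS) (hZ 1)
        (EtaleThetaDataOfSetting.Pi C) hP
    let hδ : Env₀.recon.projG (Env₀.isoX 1) = 1 :=
      EtaleThetaDataOfSetting.projG_isoX_envOfGroup_one C (τ.modAll 1) hC hS h15 L hlp hp2 hpl hζ
        (EtaleLevels.eta0_mem C hC hS τ.modAll f hf 1) (hZ 1) hP
    -- RESIDUAL named inputs: F-0620 ([EtTh] Cor. 2.18 (i)) at level `1` of `τ` — from which `hover` FOLLOWS — then the custody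
    -- list of p439820 MINUS the (R1) existence data and `hα` (now theorems), VERBATIM otherwise
    ∀ (h218i₁ : (C.rigidData (τ.modAll 1) hC hS h15 L).Cor218_i),
    let hover : ∀ x : EtaleThetaDataOfSetting.Pi C, Env₀.recon.projG (Env₀.isoX (α x)) = Env₀.recon.projG (Env₀.isoX x) :=
      fun x => EtaleThetaDataOfSetting.projG_isoX_envOfGroup_inversionAlpha_of_cor218_i C ι hι (τ.modAll 1) hC hS h15 L hlp
        hp2 hpl hζ (EtaleLevels.eta0_mem C hC hS τ.modAll f hf 1) (hZ 1) hP _ rfl h218i₁ hιA x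
    ∀ (hcharY : EtaleThetaDataOfSetting.PiYddCharacteristic C)
      -- (R1) residual: the UNIQUENESS clause only («the unique order two `Δ`-outer automorphism over `G_k`», tempered-anabelian)
      (huniq : ∀ κ : (EtaleThetaDataOfSetting.Pi C) ≃ₜ* (EtaleThetaDataOfSetting.Pi C),
        (∀ x, Env₀.recon.projG (Env₀.isoX (κ x)) = Env₀.recon.projG (Env₀.isoX x)) →
        (∃ δ' : EtaleThetaDataOfSetting.Pi C, Env₀.recon.projG (Env₀.isoX δ') = 1 ∧ ∀ x, κ (κ x) = δ' * x * δ'⁻¹) →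
        (¬ ∃ δ' : EtaleThetaDataOfSetting.Pi C, Env₀.recon.projG (Env₀.isoX δ') = 1 ∧ ∀ x, κ x = δ' * x * δ'⁻¹) →
          ∃ δ' : EtaleThetaDataOfSetting.Pi C, Env₀.recon.projG (Env₀.isoX δ') = 1 ∧ ∀ x, κ x = δ' * α x * δ'⁻¹)
      -- the L3 parameter bundle «`Π^temp` tempered, Galois-countable» of `X_v`, and the POINT: a non-cuspidal closed point `y` of
      -- the tree's tempered curve `X̲̲_v`, whose decomposition group `D_y ⊆ Π^tp_X̲̲` instantiates print's `D_{μ_-}`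
      (y : (C.temperedCurveXuuOfLevelData hlp.ne_zero gd).Pt) (hy : ¬ (C.temperedCurveXuuOfLevelData hlp.ne_zero gd).IsCusp y)
      -- what «`y = μ_-`» means in print: `D_{μ_-} ⊆ Π_Ÿ(Π)`, fixed by `ι_Ÿ` up to `Δ`-conjugacy, standard type at `D_{μ_-}`
      (hDmu : (((C.temperedCurveXuuOfLevelData hlp.ne_zero gd).decomp y : Subgroup (EtaleThetaDataOfSetting.Pi C))) ≤
        EtaleThetaDataOfSetting.PiYdd C)
      (hfixD : ∃ δ' : ↥(EtaleThetaDataOfSetting.PiYdd C), Env₀.recon.projG (Env₀.isoX (δ' : EtaleThetaDataOfSetting.Pi C)) = 1 ∧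
        ∀ (d : EtaleThetaDataOfSetting.Pi C) (hd : d ∈ ((C.temperedCurveXuuOfLevelData hlp.ne_zero gd).decomp y)),
          ((EtaleThetaDataOfSetting.iotaYddOfAut C hcharY α ⟨d, hDmu hd⟩ :
          EtaleThetaDataOfSetting.PiYdd C) : EtaleThetaDataOfSetting.Pi C) ∈
            (((C.temperedCurveXuuOfLevelData hlp.ne_zero gd).decomp y : Subgroup (EtaleThetaDataOfSetting.Pi C))).map
              (MulAut.conj ((δ' : EtaleThetaDataOfSetting.PiYdd C) : EtaleThetaDataOfSetting.Pi C)).toMonoidHom)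
      (etaStd : (EtaleThetaDataOfSetting.coh C).H1 ⊤) (hmem : etaStd ∈ EtaleThetaDataOfSetting.orbitOne C hC)
      (hstd : (2 * (EtaleLevels.setting C hC hS hlp hp2 hpl hζ τ.modAll f hf).l) •
        EtaleThetaDataOfSetting.resDmuOf C ((C.temperedCurveXuuOfLevelData hlp.ne_zero gd).decomp y) hDmu etaStd = 0)
      -- the coefficient half of the pair and its printed properties
      (β : (ThetaSetting.modelχq p 1 2 even_two).GtpTheta ≃ₜ* (ThetaSetting.modelχq p 1 2 even_two).GtpTheta)
      (hφ : ∀ g, β (EtaleThetaDataOfSetting.phi C g) = EtaleThetaDataOfSetting.phi C (α g))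
      -- (H1) `Δ` characteristic, for the GENUINE [AbsTopIII]-output data over `(K, ℚ̄_p, ε = id)` (k, ε, (H2) hq DISCHARGED below)
      (hΔX : ∀ φ : (EtaleLevels.setting C hC hS hlp hp2 hpl hζ τ.modAll f hf).PiX ≃ₜ* (EtaleLevels.setting C hC hS hlp hp2 hpl hζ τ.modAll f hf).PiX,
        (EtaleLevels.setting C hC hS hlp hp2 hpl hζ τ.modAll f hf).DeltaX.map φ.toMulEquiv.toMonoidHom =
          (EtaleLevels.setting C hC hS hlp hp2 hpl hζ τ.modAll f hf).DeltaX)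
      (hβ : ∀ a : (ThetaSetting.modelχq p 1 2 even_two).GtpTheta, a ∈ (ThetaSetting.modelχq p 1 2 even_two).lDeltaTheta l → β a = a)
      (tr : ℤ → (EtaleThetaDataOfSetting.coh C).H1 ⊤) (htr : tr 0 = etaStd)
      (hdesc : ∀ o ∈ EtaleThetaDataOfSetting.orbitOne C hC,
        ∃ (n : ℤ) (c' : (EtaleThetaDataOfSetting.coh C).H1 ⊤), 2 • c' = 0 ∧ o = tr n + c')
      (hrev : ∀ n : ℤ, IsOfFinAddOrder (EtaleThetaDataOfSetting.pairRho C α β hφ (EtaleThetaDataOfSetting.mem_lDeltaTheta_iff_of_eq_self β hβ) (EtaleThetaDataOfSetting.mem_PiYdd_iff_of_piYddCharacteristic C hcharY α) (tr n) - tr (-n)))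
      (hfree : ∀ m n : ℤ, IsOfFinAddOrder (tr m - tr n) → m = n)
      (G : IsoClass (EtaleLevels.setting C hC hS hlp hp2 hpl hζ τ.modAll f hf).Gk),
      haveI := EtaleThetaDataOfSetting.finiteIndex_map_aug_decompPoint C hlp.ne_zero gd y
      ∃ cU : CyclotomeCoefficients (EtaleThetaDataOfSetting.phi C) ((ThetaSetting.modelχq p 1 2 even_two).lDeltaTheta l) (PadicAlgCl p)ˣ,
        Function.Bijective cU.hom ∧
        (∀ (ζ : Literature.AnabelianGeometry.EtaleTheta.cyclotome (PadicAlgCl p)ˣ) (M : ℕ+),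
          (((τ.modAll M).red (cU.hom ζ) : MuN p M) : (PadicAlgCl p)ˣ) = (ζ : ℕ+ → (PadicAlgCl p)ˣ) M) ∧
        Literature.IUT.HodgeArakelov.Cor112_ii
          (EtaleLevels.thetaEvaluation C hC hS hlp hp2 hpl hζ τ.modAll f hf τ.red_modAll h15 L hZ hcharY (EtaleLevels.bijective_rigidLimHom C hC hS hlp hp2 hpl hζ τ.modAll f hf τ.red_modAll h15 L hZ) Env₀
            (EtaleThetaDataOfSetting.pointedInversionOfPair C hC hS hcharY (EtaleLevels.setting C hC hS hlp hp2 hpl hζ τ.modAll f hf)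
              (ContinuousMulEquiv.refl _) rfl Env₀ α hover 1 hδ hαα γ hγ hαγ huniq ((C.temperedCurveXuuOfLevelData hlp.ne_zero gd).decomp y) hDmu hfixD etaStd hmem hstd)
            (LevelRetraction.ofAugmentation (EtaleThetaDataOfSetting.phi C) ((ThetaSetting.modelχq p 1 2 even_two).lDeltaTheta l)
              (EtaleThetaDataOfSetting.aug C) ((C.temperedCurveXuuOfLevelData hlp.ne_zero gd).decomp y) (EtaleThetaDataOfSetting.decompPoint_eq_one_of_aug_eq_one C hlp.ne_zero gd y hy) (EtaleThetaDataOfSetting.PiYdd C)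
              (EtaleThetaDataOfSetting.continuous_aug C) (EtaleLevels.aug_ker_acts_trivially C)
              (hlift_of_isCompact (EtaleThetaDataOfSetting.aug C) ((C.temperedCurveXuuOfLevelData hlp.ne_zero gd).decomp y) (EtaleThetaDataOfSetting.continuous_aug C) (EtaleThetaDataOfSetting.isCompact_decompPoint C hlp.ne_zero gd y))
              (hemb_of_isCompact (EtaleThetaDataOfSetting.aug C) ((C.temperedCurveXuuOfLevelData hlp.ne_zero gd).decomp y) (EtaleThetaDataOfSetting.continuous_aug C) (EtaleThetaDataOfSetting.isCompact_decompPoint C hlp.ne_zero gd y) (EtaleThetaDataOfSetting.decompPoint_eq_one_of_aug_eq_one C hlp.ne_zero gd y hy)))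
            cU (EtaleThetaDataOfSetting.isOpen_stabilizer_units C) (EtaleThetaDataOfSetting.finiteIndex_stabilizer_units C)
            (unitGroup ℚ_[p] (PadicAlgCl p)) (EtaleThetaDataOfSetting.pairRhoLim C α β hφ (EtaleThetaDataOfSetting.mem_lDeltaTheta_iff_of_eq_self β hβ) (EtaleThetaDataOfSetting.mem_PiYdd_iff_of_piYddCharacteristic C hcharY α))) ∧
        ∃ Δ : MuXmuDiagram
            (EtaleLevels.thetaEvaluation C hC hS hlp hp2 hpl hζ τ.modAll f hf τ.red_modAll h15 L hZ hcharY (EtaleLevels.bijective_rigidLimHom C hC hS hlp hp2 hpl hζ τ.modAll f hf τ.red_modAll h15 L hZ) Env₀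
              (EtaleThetaDataOfSetting.pointedInversionOfPair C hC hS hcharY (EtaleLevels.setting C hC hS hlp hp2 hpl hζ τ.modAll f hf)
                (ContinuousMulEquiv.refl _) rfl Env₀ α hover 1 hδ hαα γ hγ hαγ huniq ((C.temperedCurveXuuOfLevelData hlp.ne_zero gd).decomp y) hDmu hfixD etaStd hmem hstd)
              (LevelRetraction.ofAugmentation (EtaleThetaDataOfSetting.phi C) ((ThetaSetting.modelχq p 1 2 even_two).lDeltaTheta l)
                (EtaleThetaDataOfSetting.aug C) ((C.temperedCurveXuuOfLevelData hlp.ne_zero gd).decomp y) (EtaleThetaDataOfSetting.decompPoint_eq_one_of_aug_eq_one C hlp.ne_zero gd y hy) (EtaleThetaDataOfSetting.PiYdd C)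
                (EtaleThetaDataOfSetting.continuous_aug C) (EtaleLevels.aug_ker_acts_trivially C)
                (hlift_of_isCompact (EtaleThetaDataOfSetting.aug C) ((C.temperedCurveXuuOfLevelData hlp.ne_zero gd).decomp y) (EtaleThetaDataOfSetting.continuous_aug C) (EtaleThetaDataOfSetting.isCompact_decompPoint C hlp.ne_zero gd y))
                (hemb_of_isCompact (EtaleThetaDataOfSetting.aug C) ((C.temperedCurveXuuOfLevelData hlp.ne_zero gd).decomp y) (EtaleThetaDataOfSetting.continuous_aug C) (EtaleThetaDataOfSetting.isCompact_decompPoint C hlp.ne_zero gd y) (EtaleThetaDataOfSetting.decompPoint_eq_one_of_aug_eq_one C hlp.ne_zero gd y hy)))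
              cU (EtaleThetaDataOfSetting.isOpen_stabilizer_units C) (EtaleThetaDataOfSetting.finiteIndex_stabilizer_units C)
              (unitGroup ℚ_[p] (PadicAlgCl p)) (EtaleThetaDataOfSetting.pairRhoLim C α β hφ (EtaleThetaDataOfSetting.mem_lDeltaTheta_iff_of_eq_self β hβ) (EtaleThetaDataOfSetting.mem_PiYdd_iff_of_piYddCharacteristic C hcharY α)))
            (AbsTopMonoids.genuineOfModelIsm (EtaleLevels.setting C hC hS hlp hp2 hpl hζ τ.modAll f hf) (ThetaSetting.modelχq p 1 2 even_two).toTemperedCurve.mlfClosurePadic (ThetaSetting.modelχq p 1 2 even_two).toTemperedCurve.galoisEpsilonPadic hΔX hq) G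
            ↥(AddCommGroup.torsion (EtaleLevels.thetaEnvData C hC hS hlp hp2 hpl hζ τ.modAll f hf τ.red_modAll h15 L hZ hcharY (EtaleLevels.bijective_rigidLimHom C hC hS hlp hp2 hpl hζ τ.modAll f hf τ.red_modAll h15 L hZ)).cohEnv.lim)
            (AddCommGroup.torsion (EtaleLevels.thetaEnvData C hC hS hlp hp2 hpl hζ τ.modAll f hf τ.red_modAll h15 L hZ hcharY (EtaleLevels.bijective_rigidLimHom C hC hS hlp hp2 hpl hζ τ.modAll f hf τ.red_modAll h15 L hZ)).cohEnv.lim).subtype,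
          Δ.poly₄₅ = {e | ∃ (φ : AbsTopMonoids.Genuine.qObj hq (IsoClass.base (EtaleLevels.setting C hC hS hlp hp2 hpl hζ τ.modAll f hf).PiX) ⟶ G)
              (gI : (AbsTopMonoids.genuineOfModelIsm (EtaleLevels.setting C hC hS hlp hp2 hpl hζ τ.modAll f hf) (ThetaSetting.modelχq p 1 2 even_two).toTemperedCurve.mlfClosurePadic
                (ThetaSetting.modelχq p 1 2 even_two).toTemperedCurve.galoisEpsilonPadic hΔX hq).Ism G),
            ∀ (u : ↥(unitGroup ℚ_[p] (PadicAlgCl p)))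
              (m : ↥(EtaleLevels.thetaEvaluation C hC hS hlp hp2 hpl hζ τ.modAll f hf τ.red_modAll h15 L hZ hcharY (EtaleLevels.bijective_rigidLimHom C hC hS hlp hp2 hpl hζ τ.modAll f hf τ.red_modAll h15 L hZ) Env₀
                (EtaleThetaDataOfSetting.pointedInversionOfPair C hC hS hcharY (EtaleLevels.setting C hC hS hlp hp2 hpl hζ τ.modAll f hf)
                  (ContinuousMulEquiv.refl _) rfl Env₀ α hover 1 hδ hαα γ hγ hαγ huniq ((C.temperedCurveXuuOfLevelData hlp.ne_zero gd).decomp y) hDmu hfixD etaStd hmem hstd)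
                (LevelRetraction.ofAugmentation (EtaleThetaDataOfSetting.phi C) ((ThetaSetting.modelχq p 1 2 even_two).lDeltaTheta l)
                  (EtaleThetaDataOfSetting.aug C) ((C.temperedCurveXuuOfLevelData hlp.ne_zero gd).decomp y) (EtaleThetaDataOfSetting.decompPoint_eq_one_of_aug_eq_one C hlp.ne_zero gd y hy) (EtaleThetaDataOfSetting.PiYdd C)
                  (EtaleThetaDataOfSetting.continuous_aug C) (EtaleLevels.aug_ker_acts_trivially C)
                  (hlift_of_isCompact (EtaleThetaDataOfSetting.aug C) ((C.temperedCurveXuuOfLevelData hlp.ne_zero gd).decomp y) (EtaleThetaDataOfSetting.continuous_aug C) (EtaleThetaDataOfSetting.isCompact_decompPoint C hlp.ne_zero gd y))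
                  (hemb_of_isCompact (EtaleThetaDataOfSetting.aug C) ((C.temperedCurveXuuOfLevelData hlp.ne_zero gd).decomp y) (EtaleThetaDataOfSetting.continuous_aug C) (EtaleThetaDataOfSetting.isCompact_decompPoint C hlp.ne_zero gd y) (EtaleThetaDataOfSetting.decompPoint_eq_one_of_aug_eq_one C hlp.ne_zero gd y hy)))
                cU (EtaleThetaDataOfSetting.isOpen_stabilizer_units C) (EtaleThetaDataOfSetting.finiteIndex_stabilizer_units C)
                (unitGroup ℚ_[p] (PadicAlgCl p)) (EtaleThetaDataOfSetting.pairRhoLim C α β hφ (EtaleThetaDataOfSetting.mem_lDeltaTheta_iff_of_eq_self β hβ) (EtaleThetaDataOfSetting.mem_PiYdd_iff_of_piYddCharacteristic C hcharY α))).MxTM)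
              (w : (nonzeroIntegers (ThetaSetting.modelχq p 1 2 even_two).toTemperedCurve.mlfClosurePadic.k (ThetaSetting.modelχq p 1 2 even_two).toTemperedCurve.mlfClosurePadic.K)ˣ),
              (m : (EtaleLevels.thetaEvaluation C hC hS hlp hp2 hpl hζ τ.modAll f hf τ.red_modAll h15 L hZ hcharY (EtaleLevels.bijective_rigidLimHom C hC hS hlp hp2 hpl hζ τ.modAll f hf τ.red_modAll h15 L hZ) Env₀
                (EtaleThetaDataOfSetting.pointedInversionOfPair C hC hS hcharY (EtaleLevels.setting C hC hS hlp hp2 hpl hζ τ.modAll f hf)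
                  (ContinuousMulEquiv.refl _) rfl Env₀ α hover 1 hδ hαα γ hγ hαγ huniq ((C.temperedCurveXuuOfLevelData hlp.ne_zero gd).decomp y) hDmu hfixD etaStd hmem hstd)
                (LevelRetraction.ofAugmentation (EtaleThetaDataOfSetting.phi C) ((ThetaSetting.modelχq p 1 2 even_two).lDeltaTheta l)
                  (EtaleThetaDataOfSetting.aug C) ((C.temperedCurveXuuOfLevelData hlp.ne_zero gd).decomp y) (EtaleThetaDataOfSetting.decompPoint_eq_one_of_aug_eq_one C hlp.ne_zero gd y hy) (EtaleThetaDataOfSetting.PiYdd C)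
                  (EtaleThetaDataOfSetting.continuous_aug C) (EtaleLevels.aug_ker_acts_trivially C)
                  (hlift_of_isCompact (EtaleThetaDataOfSetting.aug C) ((C.temperedCurveXuuOfLevelData hlp.ne_zero gd).decomp y) (EtaleThetaDataOfSetting.continuous_aug C) (EtaleThetaDataOfSetting.isCompact_decompPoint C hlp.ne_zero gd y))
                  (hemb_of_isCompact (EtaleThetaDataOfSetting.aug C) ((C.temperedCurveXuuOfLevelData hlp.ne_zero gd).decomp y) (EtaleThetaDataOfSetting.continuous_aug C) (EtaleThetaDataOfSetting.isCompact_decompPoint C hlp.ne_zero gd y) (EtaleThetaDataOfSetting.decompPoint_eq_one_of_aug_eq_one C hlp.ne_zero gd y hy)))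
                cU (EtaleThetaDataOfSetting.isOpen_stabilizer_units C) (EtaleThetaDataOfSetting.finiteIndex_stabilizer_units C)
                (unitGroup ℚ_[p] (PadicAlgCl p)) (EtaleThetaDataOfSetting.pairRhoLim C α β hφ (EtaleThetaDataOfSetting.mem_lDeltaTheta_iff_of_eq_self β hβ) (EtaleThetaDataOfSetting.mem_PiYdd_iff_of_piYddCharacteristic C hcharY α))).Hd) =
                  Multiplicative.toAdd (h1LimKummer (EtaleThetaDataOfSetting.phi C) ((ThetaSetting.modelχq p 1 2 even_two).lDeltaTheta l) ((C.temperedCurveXuuOfLevelData hlp.ne_zero gd).decomp y) cU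
                    (EtaleThetaDataOfSetting.isOpen_stabilizer_units C) (EtaleThetaDataOfSetting.finiteIndex_stabilizer_units C) u) →
              ((w : nonzeroIntegers (ThetaSetting.modelχq p 1 2 even_two).toTemperedCurve.mlfClosurePadic.k (ThetaSetting.modelχq p 1 2 even_two).toTemperedCurve.mlfClosurePadic.K) :
                  (ThetaSetting.modelχq p 1 2 even_two).toTemperedCurve.mlfClosurePadic.K) = ((u : (PadicAlgCl p)ˣ) : PadicAlgCl p) →
                e (Multiplicative.ofAdd (QuotientAddGroup.mk m)) =
                  (AbsTopMonoids.genuineOfModelIsm (EtaleLevels.setting C hC hS hlp hp2 hpl hζ τ.modAll f hf) (ThetaSetting.modelχq p 1 2 even_two).toTemperedCurve.mlfClosurePadic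
                      (ThetaSetting.modelχq p 1 2 even_two).toTemperedCurve.galoisEpsilonPadic hΔX hq).actIsm G gI
                    (QuotientGroup.mk (Units.map (AbsTopMonoids.Genuine.liftM (ThetaSetting.modelχq p 1 2 even_two).toTemperedCurve.mlfClosurePadic
                      (AbsTopMonoids.Genuine.phiOf (ThetaSetting.modelχq p 1 2 even_two).toTemperedCurve.mlfClosurePadic (ThetaSetting.modelχq p 1 2 even_two).toTemperedCurve.galoisEpsilonPadic φ)).toMonoidHom w))} := by
  intro ι hιA hC hS K₀ C f hf h15 L hO hYcl hp2 hpl hζ hZ gd hq hι α hαα γ hγ hαγ hP Env₀ hδ h218i₁ hover hcharY huniq y hy hDmu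
    hfixD etaStd hmem hstd β hφ hΔX hβ tr htr hdesc hrev hfree G
  letI : IsNonarchimedeanLocalField ℚ_[p] := Padic.isNonarchimedeanLocalField_holds p
  haveI : FiniteDimensional ℚ_[p] (ThetaSetting.modelχq p 1 2 even_two).K :=
    (ThetaSetting.modelχq p 1 2 even_two).finiteDimensional_K
  haveI : ((ThetaSetting.modelχq p 1 2 even_two).lDeltaTheta l).Normal :=
    (ThetaSetting.modelχq p 1 2 even_two).lDeltaTheta_normal l
  haveI : IsMulCommutative ((ThetaSetting.modelχq p 1 2 even_two).lDeltaTheta l) :=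
    EtaleThetaDataOfSetting.instIsMulCommutative_lDeltaTheta (D := ThetaSetting.modelχq p 1 2 even_two) l
  letI : MulDistribMulAction (EtaleThetaDataOfSetting.Pi C) (PadicAlgCl p)ˣ := EtaleThetaDataOfSetting.unitsAction C
  -- the closer of record at `Env := Env₀`, `α := ι|Π^tp_X̲̲`, `δ := 1`, the generator `γ`; `hα := aug_inversionAlpha`
  exact @EtaleLevels.cor112_model_of_cyclotomeTower_decompPoint_min p _ (ThetaSetting.modelχq p 1 2 even_two) _ _ C hC hS
    hlp hp2 hpl hζ τ.modAll f hf τ.red_modAll h15 L hZ hcharY Env₀ α hover 1 hδ hαα γ hγ hαγ huniq gd y hy hDmu hfixD etaStd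
    hmem hstd β hφ (↥(ThetaSetting.modelχq p 1 2 even_two).K) _
    (FiniteExtension.valuativeRel ℚ_[p] (ThetaSetting.modelχq p 1 2 even_two).K)
    (FiniteExtension.topologicalSpace ℚ_[p] (ThetaSetting.modelχq p 1 2 even_two).K)
    (FiniteExtension.isNonarchimedeanLocalField ℚ_[p] (ThetaSetting.modelχq p 1 2 even_two).K)
    (charZero_of_injective_algebraMap (algebraMap ℚ_[p] (ThetaSetting.modelχq p 1 2 even_two).K).injective) _
    (Literature.FieldTheory.Galois.isAlgClosure_of_intermediateField (ThetaSetting.modelχq p 1 2 even_two).K) _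
    (ThetaSetting.modelχq p 1 2 even_two).finiteDimensional_K _
    (ThetaSetting.modelχq p 1 2 even_two).toTemperedCurve.galoisEpsilonPadic hΔX hq hO
    (isCompact_deltaTheta_modelχq p 1 2 even_two) (EtaleThetaDataOfSetting.aug_inversionAlpha C ι hι hιA) hβ tr htr hdesc
    hrev hfree G

end ModelTateCarriers

end Literature.IUT.HodgeArakelov

end
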